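import Summits.Parity.GeneralizedHardyLittlewood.Theorems.ModelHyperbolicity.Negative.ModelHyperbolicityLoadBearing
import HarnessLib

/-!
# Route `LeeYangFibres`, crux `ModelHyperbolicity` (stmt-Parity-14110):
# vocabulary of the line `window-chain-transport`

Route-posited objects (D-0016 `<Route><Crux>Defs` file) shared by the registered stubs of the skeleton
`Cruxes/ModelHyperbolicity/Lines/window-chain-transport.lean` (as reshaped by the line lead) and by the
crux file that composes them. Nothing is asserted: every `def … : Prop` below is a *statement* (a
registered stub signature or a hypothesis bundle), consumed only as the type of a stub theorem or as an
explicit hypothesis. The finite-`x` objects `cell u x j = A_j(x)`, `cellPoly`, `RealRootedAt`,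
`cellPolyQ` are the LANDED ones of `Theorems/ModelHyperbolicity/Negative/*` (imported, not restated).

Objects:
* `cellDensity j u = I_{j+1}(u)` — the Alladi–Buchstab cell densities, index-shifted: `I_1 ≡ 1`,
  `I_{j+2}(u) = ∫_1^{max(u-1,1)} I_{j+1}(t) dt/t` (so `I_{j+1}(u) = 0` for `u ≤ j+1`, `I_2(u) = log(u-1)`
  for `u ≥ 2`, `Σ_j I_j(u) = u·ω(u)`); heuristically/classically `A_{j+1}(x) ~ I_{j+1}(u)·x/log x` at
  roughness `x^{1/u}` (Alladi 1982, Quart. J. Math. Oxford (2) 33, 129–148; Tenenbaum, *Introduction…*,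
  III.6). The `max` keeps the recursion total and continuous.
* `modelEval N u z = G_N(u;z) = Σ_{j<N} I_{j+1}(u) z^j ∈ ℂ` — the model polynomial family (the limit of
  the reduced cell polynomial `P_{u,x}(z)/z · log x/x` when `N = u ∈ ℕ`), and `modelPoly u ∈ ℝ[X]`, the
  same at integer `u` as an honest real polynomial (compare `Negative.cellPolyQ u x = Σ_{j<u} A_{j+1}(x) X^j`).
* `omegaCell N X j = #{1 ≤ n ≤ X : N ≤ P⁻(n), Ω(n) = j}` — the Ω-cells of the rough integers with an
  INTEGER threshold (the tree's `roughIcc N X` split by `Ω`); `cell u x j = omegaCell (⌊x^{1/u}⌋₊ + 1) x j`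
  (`cell_eq_omegaCell`).
* Statements: `DensityCalculus` (continuity / vanishing / positivity / FTC / Volterra identity for the
  densities and the model family — the calculus every other stub consumes), `WindowChain N` (THE LEVER:
  the Hermite–Biehler positivity pair on every unit window), `NoNullWindow` (backward uniqueness for the
  delay equation), `ModelSimple u` (`u-2` simple real zeros of `modelPoly u`), `SimpleZerosStep`,
  `CellRate` (Alladi's cell asymptotics WITH RATE, in the tree's `(X, Y)`-format of
  `RoughNumbersBuchstab.lean`), `CellAsymptotics u` (the limit form at integer roughness),
  `CellLimitStep`, `TransferStep`.
* Small sorry-free API: `cellDensity_zero`, `cellDensity_succ_of_le_two`, `modelEval_of_le_two`,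
  `modelEval_zero_right`, `modelPoly_coeff`, `modelPoly_eval`, `modelPoly_map_eval`, `cell_eq_omegaCell`.
* The registered bookkeeping stub `stub_glue` (the composition of the line: pure logic in the six other stub
  STATEMENTS, concluding the crux in its factored form `∀ u ≥ 2, ∃ x₀, ∀ x ≥ x₀, RealRootedAt u x`) is proved at the
  end; through it this vocabulary file lands as a `--supports` file of stmt-Parity-14110 (precedent:
  `BECConjugateDominationDefs.lean` / `stub_imuOfParts`).

References: line card `Cruxes/ModelHyperbolicity/Lines/window-chain-transport.md`; K. Alladi, Quart. J.
Math. Oxford (2) 33 (1982) 129–148 [Alladi1982]; G. Tenenbaum, *Introduction to analytic and probabilistic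
number theory*, III.6 [Tenenbaum2015]; J. Borcea, P. Brändén, Invent. Math. 177 (2009) [BorceaBranden2009]
and D. G. Wagner, Bull. AMS 48 (2011) §2 [Wagner2011] (proper position in half-plane form — dictionary only).
-/

noncomputable section

namespace Summit.Parity.GeneralizedHardyLittlewood.Cruxes.ModelHyperbolicity.WindowChainTransport

open scoped BigOperators
open Polynomial Filter
open Summit.Parity.GeneralizedHardyLittlewood.Theorems.ModelHyperbolicity.Negative (cell RealRootedAt)

/-! ## Objects -/

/-- **Alladi–Buchstab cell densities**, index-shifted: `cellDensity j u = I_{j+1}(u)`, with `I_1 ≡ 1`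
and `I_{j+2}(u) = ∫_1^{max(u-1,1)} I_{j+1}(t) dt/t`. -/
def cellDensity : ℕ → ℝ → ℝ
  | 0, _ => 1
  | j + 1, u => ∫ t in (1 : ℝ)..max (u - 1) 1, cellDensity j t / t

/-- **The model polynomial family, evaluated**: `modelEval N u z = Σ_{j<N} I_{j+1}(u) z^j`. -/
def modelEval (N : ℕ) (u : ℝ) (z : ℂ) : ℂ :=
  ∑ j ∈ Finset.range N, (cellDensity j u : ℂ) * z ^ j

/-- **The real model polynomial at integer roughness** `u`: `Σ_{j<u} I_{j+1}(u) X^j ∈ ℝ[X]`. -/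
def modelPoly (u : ℕ) : ℝ[X] :=
  ∑ j ∈ Finset.range u, C (cellDensity j u) * X ^ j

/-- **Ω-cells of the rough integers with an integer threshold**:
`omegaCell N X j = #{1 ≤ n ≤ X : N ≤ P⁻(n), Ω(n) = j}` (`P⁻ = Nat.minFac`, `Ω = cardFactors`;
`n = 1` has `P⁻(1) = 1`, `Ω(1) = 0`). -/
def omegaCell (N X j : ℕ) : ℕ :=
  ((Finset.Icc 1 X).filter (fun n => N ≤ Nat.minFac n ∧ ArithmeticFunction.cardFactors n = j)).card

/-! ## Statements (types of the registered stubs and their hypothesis bundles) -/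

/-- **The calculus of the densities and of the model family** (type of `stub_calculus`; hypothesis of
most other stubs): (C1) every `cellDensity j` is continuous on `ℝ`; (C2) `I_{j+2}(u) = 0` for
`u ≤ j+2`; (C3) `I_{j+1}(u) > 0` for `u > j+1`; (C4) FTC: `I_{j+2}'(u) = I_{j+1}(u-1)/(u-1)` for `u > 2`;
(C5) `τ ↦ G_N(τ;z)` is continuous; (C6) the delay equation
`∂_τ G_N(τ;z) = z·G_N(τ-1;z)/(τ-1)` for `2 < τ ≤ N+1`, `N ≥ 2`; (C7) its VOLTERRA form
`G_N(s;z) − G_N(σ;z) = z ∫_{max(σ-1,1)}^{max(s-1,1)} G_N(τ;z) dτ/τ` for `1 ≤ σ ≤ s ≤ N+1`, `N ≥ 2`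
(in (C6)–(C7) the would-be top term vanishes by (C2); both FAIL at `N = 1`, where `G_1 ≡ 1`). -/
def DensityCalculus : Prop :=
  (∀ j : ℕ, Continuous (cellDensity j)) ∧
  (∀ j : ℕ, ∀ u : ℝ, u ≤ (j : ℝ) + 2 → cellDensity (j + 1) u = 0) ∧
  (∀ j : ℕ, ∀ u : ℝ, (j : ℝ) + 1 < u → 0 < cellDensity j u) ∧
  (∀ j : ℕ, ∀ u : ℝ, 2 < u → HasDerivAt (cellDensity (j + 1)) (cellDensity j (u - 1) / (u - 1)) u) ∧
  (∀ N : ℕ, ∀ z : ℂ, Continuous (fun τ : ℝ => modelEval N τ z)) ∧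
  (∀ N : ℕ, 2 ≤ N → ∀ z : ℂ, ∀ τ : ℝ, 2 < τ → τ ≤ (N : ℝ) + 1 →
    HasDerivAt (fun t : ℝ => modelEval N t z) (z * modelEval N (τ - 1) z / ((τ : ℂ) - 1)) τ) ∧
  (∀ N : ℕ, 2 ≤ N → ∀ z : ℂ, ∀ σ s : ℝ, 1 ≤ σ → σ ≤ s → s ≤ (N : ℝ) + 1 →
    modelEval N s z - modelEval N σ z =
      z * ∫ τ in max (σ - 1) 1..max (s - 1) 1, modelEval N τ z / (τ : ℂ))

/-- **THE INVARIANT — the unit window is a chain (Hermite–Biehler positivity pair).** For all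
`1 ≤ τ ≤ t ≤ τ + 1` with `t ≤ N` and all `z` in the open upper half-plane: `G_N(τ;z), G_N(t;z) ≠ 0`,
`Im(G_N(t;z)/G_N(τ;z)) ≥ 0` (weak proper position `G(τ) ≼ G(t)`) and `Im(z·G_N(τ;z)/G_N(t;z)) > 0`
(strict: `G(t) ≺ z·G(τ)`). Sharp: span `1` holds, span `1.25` fails numerically. -/
def WindowChain (N : ℕ) : Prop :=
  ∀ τ t : ℝ, 1 ≤ τ → τ ≤ t → t ≤ τ + 1 → t ≤ (N : ℝ) → ∀ z : ℂ, 0 < z.im →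
    modelEval N τ z ≠ 0 ∧ modelEval N t z ≠ 0 ∧
      0 ≤ (modelEval N t z / modelEval N τ z).im ∧ 0 < (z * modelEval N τ z / modelEval N t z).im

/-- **No null window** (backward uniqueness for the delay equation): for `z ≠ 0`, `τ ↦ G_N(τ;z)`
cannot vanish on a whole unit window `[a, a+1] ⊆ [1, N]`. -/
def NoNullWindow : Prop :=
  ∀ N : ℕ, ∀ z : ℂ, z ≠ 0 → ∀ a : ℝ, 1 ≤ a → a + 1 ≤ (N : ℝ) →
    ∃ τ ∈ Set.Icc a (a + 1), modelEval N τ z ≠ 0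

/-- **Model simplicity at integer `u`**: `modelPoly u` has degree `≤ u - 2` and at least `u - 2`
DISTINCT real roots (so exactly `u - 2` simple real zeros and nothing else). -/
def ModelSimple (u : ℕ) : Prop :=
  (modelPoly u).natDegree ≤ u - 2 ∧ u - 2 ≤ (modelPoly u).roots.toFinset.card

/-- The SIMPLICITY step (type of `stub_simpleZeros`). -/
def SimpleZerosStep : Prop :=
  DensityCalculus → (∀ N : ℕ, WindowChain N) → NoNullWindow → ∀ u : ℕ, 2 ≤ u → ModelSimple u

/-- **Alladi's cell asymptotics WITH RATE, in the tree's `(X, Y)`-format** (type of `stub_cellRate`):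
for every `j, k` there is `C` such that for all real `2 ≤ Y ≤ X` with `log X ≤ k·log Y`,
`|#{n ≤ X : P⁻(n) ≥ Y, Ω(n) = j+1} − (X·I_{j+1}(log X/log Y)/log X − [j = 0]·Y/log Y)| ≤ C·X/log² Y`
(`j = 0`: the prime number theorem with de la Vallée Poussin's error; `j ≥ 1`: induction over
Buchstab's identity by the least prime factor, Abel summation through `ϑ`, and
`(v·σ)' = …`-type integral identities of the densities — the `Ω`-split of the tree's
`Literature.NumberTheory.Sieve.exists_abs_card_roughIcc_sub_main_le`; Alladi 1982, Tenenbaum III.6).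
A statement (registered stub type), not a fact. -/
def CellRate : Prop :=
  ∀ j k : ℕ, ∃ C : ℝ, ∀ X Y : ℝ, 2 ≤ Y → Y ≤ X → Real.log X ≤ k * Real.log Y →
    |(omegaCell ⌈Y⌉₊ ⌊X⌋₊ (j + 1) : ℝ) -
        (X * cellDensity j (Real.log X / Real.log Y) / Real.log X - if j = 0 then Y / Real.log Y else 0)| ≤
      C * X / Real.log Y ^ 2

/-- **Alladi's cell asymptotics at integer roughness `u`, limit form**:
`A_{j+1}(x)·log x/x → I_{j+1}(u)` as `x → ∞` through `ℕ`, for every `j`. -/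
def CellAsymptotics (u : ℕ) : Prop :=
  ∀ j : ℕ, Tendsto (fun x : ℕ => (cell u x (j + 1) : ℝ) * Real.log x / x) atTop
    (nhds (cellDensity j u))

/-- The LIMIT step (type of `stub_cellLimit`): rate form ⇒ limit form at every integer `u ≥ 2`
(apply `CellRate` at `Y = ⌊x^{1/u}⌋₊ + 1`, `X = x`, `k = u + 1`; continuity of `I_{j+1}` at `u`). -/
def CellLimitStep : Prop :=
  DensityCalculus → CellRate → ∀ u : ℕ, 2 ≤ u → CellAsymptotics u

/-- The FINITE-`x` TRANSFER (type of `stub_transfer`): `u - 2` simple real model zeros + cell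
asymptotics ⇒ the reduced cell polynomial alternates in sign at `u - 1` fixed points for `x ≥ x₀(u)`
⇒ `RealRootedAt u x` (landed `Negative.realRootedAt_of_alternating`). -/
def TransferStep : Prop :=
  ∀ u : ℕ, 2 ≤ u → ModelSimple u → CellAsymptotics u → ∃ x₀ : ℕ, ∀ x : ℕ, x₀ ≤ x → RealRootedAt u x

/-! ## Small sorry-free API -/

/-- `I_1 ≡ 1`. -/
@[simp] theorem cellDensity_zero (u : ℝ) : cellDensity 0 u = 1 := by
  simp [cellDensity]

/-- Above index `0` the densities vanish on `u ≤ 2` (the integral runs over `[1,1]`). -/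
theorem cellDensity_succ_of_le_two (j : ℕ) {u : ℝ} (hu : u ≤ 2) : cellDensity (j + 1) u = 0 := by
  have h : max (u - 1) 1 = 1 := max_eq_right (by linarith)
  simp [cellDensity, h]

/-- On the base window `u ≤ 2` the model polynomial is the constant `1` (any truncation `N ≥ 1`). -/
theorem modelEval_of_le_two {N : ℕ} (hN : 1 ≤ N) {u : ℝ} (hu : u ≤ 2) (z : ℂ) : modelEval N u z = 1 := by
  unfold modelEval
  obtain ⟨M, rfl⟩ : ∃ M, N = M + 1 := ⟨N - 1, by omega⟩
  rw [Finset.sum_range_succ']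
  simp [cellDensity_succ_of_le_two _ hu]

/-- The constant coefficient of the model family is `I_1 = 1`: `G_N(u;0) = 1`. -/
theorem modelEval_zero_right {N : ℕ} (hN : 1 ≤ N) (u : ℝ) : modelEval N u 0 = 1 := by
  unfold modelEval
  obtain ⟨M, rfl⟩ : ∃ M, N = M + 1 := ⟨N - 1, by omega⟩
  rw [Finset.sum_range_succ']
  simp

/-- Coefficients of `modelPoly u`: `I_{i+1}(u)` for `i < u`. -/
theorem modelPoly_coeff (u i : ℕ) :
    (modelPoly u).coeff i = if i < u then cellDensity i u else 0 := by
  unfold modelPoly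
  rw [finsetSum_coeff]
  simp only [coeff_C_mul_X_pow]
  rw [Finset.sum_ite_eq]
  simp [Finset.mem_range]

/-- Real evaluation of `modelPoly u`. -/
theorem modelPoly_eval (u : ℕ) (t : ℝ) :
    (modelPoly u).eval t = ∑ j ∈ Finset.range u, cellDensity j u * t ^ j := by
  unfold modelPoly
  rw [eval_finsetSum]
  simp only [eval_mul, eval_C, eval_pow, eval_X]

/-- `modelPoly u` pushed to `ℂ` evaluates to `modelEval u u`. -/
theorem modelPoly_map_eval (u : ℕ) (z : ℂ) :
    ((modelPoly u).map (algebraMap ℝ ℂ)).eval z = modelEval u u z := by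
  unfold modelPoly modelEval
  rw [Polynomial.map_sum, eval_finsetSum]
  simp only [Polynomial.map_mul, Polynomial.map_C, Polynomial.map_pow, Polynomial.map_X, eval_mul, eval_C,
    eval_pow, eval_X, Complex.coe_algebraMap]

/-- The finite-`x` cells of the crux are Ω-cells with the integer threshold `⌊x^{1/u}⌋₊ + 1`:
`x^{1/u} < P⁻(n) ↔ ⌊x^{1/u}⌋₊ + 1 ≤ P⁻(n)`. -/
theorem cell_eq_omegaCell (u x j : ℕ) : cell u x j = omegaCell (⌊(x : ℝ) ^ ((1 : ℝ) / u)⌋₊ + 1) x j := by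
  unfold cell omegaCell
  congr 1
  refine Finset.filter_congr fun n _ => ?_
  have h0 : (0 : ℝ) ≤ (x : ℝ) ^ ((1 : ℝ) / u) := by positivity
  rw [Nat.add_one_le_iff, Nat.floor_lt h0]


/-! ## The registered bookkeeping stub: the composition of the line -/

/-- **`stub_glue` (registered; pure logic).** The six mathematical stubs compose to the crux in its factored form:
for `u ≥ 2`, `simpleZeros calc windowChain.1 windowChain.2 u` gives `ModelSimple u`, `cellLimit calc cellRate u`
gives `CellAsymptotics u`, and `transfer u` turns the two into `∃ x₀, ∀ x ≥ x₀, RealRootedAt u x`. -/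
theorem stub_glue : DensityCalculus → (DensityCalculus → (∀ N : ℕ, WindowChain N) ∧ NoNullWindow) →
    SimpleZerosStep → TransferStep → CellRate → CellLimitStep →
    ∀ u : ℕ, 2 ≤ u → ∃ x₀ : ℕ, ∀ x : ℕ, x₀ ≤ x → RealRootedAt u x :=
  fun hA hB hD hE hF hG u hu => hE u hu (hD hA (hB hA).1 (hB hA).2 u hu) (hG hA hF u hu)

end Summit.Parity.GeneralizedHardyLittlewood.Cruxes.ModelHyperbolicity.WindowChainTransport

end
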